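import Summits.BirchSwinnertonDyer.BirchSwinnertonDyer.Theorems.AdditiveBranchIMCGordTwoTwistedFrameTwo
import Summits.BirchSwinnertonDyer.BirchSwinnertonDyer.Theorems.AdditiveBranchIMCGordTwoTwistedFlatLoose
import Summits.BirchSwinnertonDyer.BirchSwinnertonDyer.Theorems.AdditiveBranchIMCTwistTypePartnerDataDyadic
import Summits.BirchSwinnertonDyer.BirchSwinnertonDyer.Theorems.AdditiveBranchIMCGordTwoTwistedWanTwoDefs
import Literature.NumberTheory.EllipticCurves.CastellaLiuWan2022.GreenbergDivisibilityAwayFromCyclotomicSemistableTwistRamifiedAtTwo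
import HarnessLib

/-!
# Route `AdditiveBranchIMC`, crux `GordTwoRankZeroOffCaseOne` (19357), line `three_field_road`, DOOR D («`ℓ₀ = 2` as the `K`-ramified twisted Wan
# prime», LeadReport27 §5 item 1): the ♭-inclusion chain at a DYADIC twisted road field (LEAD g19; `--supports` 19357, helper only)

The `ℓ₀ = 2` sibling of `AdditiveBranchIMCGordTwoTwistedFlatLoose.lean` (LEAD g18, p816807; itself the port of `WanAnyRoad.awayFromCyc_wanAny` /
`greenbergInclusion_wanAny` / `flatInclusion_wanAny`), with the field hypothesis `TameRoadFieldTwistedLoose W p q K` (odd road prime `q`)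
REPLACED by `TameRoadFieldTwistedTwo W p t K` (`AdditiveBranchIMCGordTwoTwistedWanTwoDefs.lean`, p819191: `E` additive at `2`, `W₁ = E^{(t)}`
multiplicative at `2`, `2` RAMIFIED in `K` in the dyadic non-split genus class, every odd prime of `N_E` split, `p` split), and the three typed
inputs replaced by their DYADIC siblings: Castella–Liu–Wan Thm. 8.2.1 / §6.1 in the reading R2₂ (wi-101331,
`…_semistableTwistRamifiedAtTwo`: the semistable partner `V₀ ≅ E^{(p*·d)}` with `d % 4 ≠ 1`, `2 ∣ N_{V₀}` from
`TwistTypePartnerData.exists_semistable_partner_data_dyadic`, p819302; `q := 2` serves as CLW's non-split ramified prime), Hsieh Thm. B in the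
reading R3₂ (wi-101332, through `exists_frame_and_restriction_twisted_two`, p819232). NO unit cut: `p ∤ 2 + 1` is automatic for `p ≥ 5`.
* `awayFromCyc_twisted_two`, `greenbergInclusion_twisted_two`, `flatInclusion_twisted_two`.
Theorems only (no definition, no named fact, no `sorry`); 19357 / 19358 stay OPEN; BSD is proved for no curve.
References: [CastellaLiuWan2022] Thm. 8.2.1, §6.1, §5.2 (q = 2 clause); [JetchevSkinnerWan2017] Thm. 6.1.6; [Hsieh2014] Thm. B; [Wan2020RankinSelbergIMC]
§7.5; [SkinnerUrban2014] Prop. 3.2.8. presearch: n/a (kernel port over typed readings; pen e21 §2 (i) is the print audit at `q = 2`).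
-/

set_option autoImplicit false
set_option linter.dupNamespace false

noncomputable section

open scoped Classical
open NumberField IsDedekindDomain IsDedekindDomain.HeightOneSpectrum Rat.HeightOneSpectrum
open WeierstrassCurve Literature.NumberTheory.EllipticCurves
open Literature.NumberTheory.EllipticCurves.Rank1Residual
open Literature.NumberTheory.QuadraticFields
open Summit.BirchSwinnertonDyer.Rank1Residual
open Summit.BirchSwinnertonDyer.Rank1Residual.Additive
open Summit.BirchSwinnertonDyer.BirchSwinnertonDyer.Theorems
open ThreeFieldRoadSupply

namespace Summit.BirchSwinnertonDyer.BirchSwinnertonDyer.Theorems.TwistedWanRoad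

section FlatChain

open Literature.NumberTheory.EllipticCurves.ModularForms Literature.NumberTheory.EllipticCurves.Rank1Residual.Typed Field
open WanAnyRoad

/-- THE TWO-VARIABLE DIVISIBILITY AWAY FROM THE CYCLOTOMIC VARIABLE WITH ITS ANTICYCLOTOMIC RESTRICTION AT A DYADIC TWISTED ROAD FIELD (the
`ℓ₀ = 2` sibling of `awayFromCyc_twisted_loose`), for a curve of cell (G-ord, `e = 2`) with `p ≥ 5`, `ρ̄` onto, odd additive primes `≠ p` of
quadratic-twist type, at a dyadic twisted road field `K` (`TameRoadFieldTwistedTwo W p t K`: `E` additive at `2`, `E^{(t)}` multiplicative at `2`,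
`2` ramified in `K` in the non-split genus class): for every parametrisation `Dt` of level `N_E`, anticyclotomic `(κ, γ)`, degree-one `𝔭 ∣ p`,
`𝔭′ ≠ 𝔭` over `p`, embedding datum `ι′` inducing `𝔭`, `X_ac^∅(E_K)_{𝔭′}` `Λ`-torsion and every completing pair `(κ₁, γ₁)`, a two-variable fraction
`A/B` with `B(0,·) ≠ 0`, a non-zero `h` in the cyclotomic variable alone, a ♭-frame `(Ω_K′, Ω_p′, Q′)` and the restriction `D` with
`h·B·ch_{Λ₂}(X_Gr₂)·Λ^ur ⊆ (A)`, `A(0,·) = B(0,·)·D`, `D ≠ 0`, `(D) ⊆ (Q′)`. Proof: the SEMISTABLE partner `V₀ ≅ E^{(p*·d)}`, `d = t·∏ℓ*`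
(`exists_semistable_partner_data_dyadic`: `d % 4 ≠ 1`, `2 ∣ N_{V₀}`; the odd primes of `d` divide `N_E`, hence split in `K`), print Thm. 8.2.1 ∘
JSW 6.1.6 and §6.1 in the reading R2₂ (`h821`, `h61`; CLW's non-split ramified prime `q := 2`) with the base-change clause
`baseChange_nonsplit_two_of_tameRoadFieldTwistedTwo`, hypothesis (T) from `TameXGr₂Torsion.isTorsion_XGr₂_cellGordTwo`, clause (ii) from
`exists_frame_and_restriction_twisted_two` (Hsieh Thm. B, reading R3₂). The unit cut `p ∤ 2 + 1` is automatic (`p ≥ 5`).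
[cite: CastellaLiuWan2022, Thm. 8.2.1 (p. 85), §6.1 (p. 51) and §5.2 (p. 34, the q = 2 clause) (Forum Math. Sigma 10 (2022) e110)]
[cite: JetchevSkinnerWan2017, Thm. 6.1.6 (arXiv:1512.06894 p. 26)] [cite: Hsieh2014, Thm. B (Doc. Math. 19 p. 712)] -/
theorem awayFromCyc_twisted_two
    (hB : Hsieh2014.thmB_exists_isHsiehLFunction_coeff_norm_eq_one_unrPeriod_ramifiedTwistedSteinbergAtTwo)
    (h821 : CastellaLiuWan2022.thm821_XGr₂_charIdeal_mul_le_awayFromCyc_semistableTwistRamifiedAtTwo)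
    (h61 : CastellaLiuWan2022.sec61_exists_isCastellaLiuWanLFunction₂_semistableTwistRamifiedAtTwo)
    (W : WeierstrassCurve ℚ) [W.IsElliptic] [W.IsGloballyMinimal] (p : ℕ) [Fact p.Prime]
    {t : ℤ} (K : Type) [Field K] [NumberField K]
    (hcell : N10.CellGordTwo W p) (hp5 : 5 ≤ p) (hsurj : Surj W p)
    (htt : ∀ r : Nat.Primes, (r : ℕ) ≠ 2 → W.HasAdditiveReductionAt ((primesEquiv (R := ℤ)).symm r) →
      ¬ (W.quadraticTwist (((-1 : ℤ) ^ ((r : ℕ) / 2) * r : ℤ) : ℚ)).HasAdditiveReductionAt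
        ((primesEquiv (R := ℤ)).symm r))
    (hK : TameRoadFieldTwistedTwo W p t K) :
    ∀ (N : ℕ) [NeZero N] (Dt : ModularParametrizationData W N), W.conductorNorm ℤ = N →
    ∀ (κ : ZpExtension K p), κ.IsAnticyclotomic → ∀ (γ : Field.absoluteGaloisGroup K) [Fact (κ.IsTopGenerator γ)]
      (𝔭 : HeightOneSpectrum (𝓞 K)), ((p : ℕ) : 𝓞 K) ∈ 𝔭.asIdeal → 𝔭.asIdeal.ramificationIdx (𝓞 ℚ) = 1 →
      𝔭.asIdeal.inertiaDeg (𝓞 ℚ) = 1 → ∀ (𝔭' : HeightOneSpectrum (𝓞 K)), ((p : ℕ) : 𝓞 K) ∈ 𝔭'.asIdeal → 𝔭' ≠ 𝔭 →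
      ∀ (ι' : PadicAlgCl p ≃+* ℂ), SchneiderFree.BranchInducesPrime p ι' 𝔭 →
        Module.IsTorsion (IwasawaAlgebra p) (X11b.AcSelmer.XAc (W.baseChange K) p κ 𝔭' ∅ γ) →
        ∀ (κ₁ : ZpExtension K p) (γ₁ : Field.absoluteGaloisGroup K) [Fact (ZpExtension.IsTopGeneratorPair κ₁ κ γ₁ γ)],
          ∃ (A B : PowerSeries (PowerSeries (PadicComplexInt p))) (h : PowerSeries (PadicComplexInt p))
            (ΩK' : ℂ) (Ωp' : ℂ_[p]) (Q' D : PowerSeries (PadicComplexInt p)),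
            h ≠ 0 ∧ ΩK' ≠ 0 ∧ Ωp' ≠ 0 ∧ X11b.R1.IsBDPLFunctionInt p ι' 𝔭 κ γ Dt.f ΩK' Ωp' Q' ∧
            (∀ y ∈ (WeierstrassCurve.XGr₂.charIdeal (W.baseChange K) p κ₁ κ 𝔭' γ₁ γ).map
                (IwasawaAlgebra₂.toUnr₂ p (X11b.R1.toCpInt p)),
              PowerSeries.map (PowerSeries.C : PadicComplexInt p →+* PowerSeries (PadicComplexInt p)) h * B * y ∈
                Ideal.span {A}) ∧
            PowerSeries.constantCoeff B ≠ 0 ∧ PowerSeries.constantCoeff A = PowerSeries.constantCoeff B * D ∧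
            D ≠ 0 ∧ Ideal.span {D} ≤ Ideal.span {Q'} := by
  intro N _ Dt hN κ hκ γ hγ 𝔭 h𝔭 _ _ 𝔭' h𝔭' hne ι' hind htors κ₁ γ₁ hpair
  have hp2 : p ≠ 2 := by omega
  -- the unit cut at `ℓ₀ = 2` is automatic: `p ∤ 3` for `p ≥ 5`
  have hcut : ¬ p ∣ 2 + 1 := fun h ↦ by
    have := Nat.le_of_dvd (by norm_num) h
    omega
  -- the field data (dyadic twisted Wan prime `t`, `2` ramified in the non-split genus class)
  have hbc := baseChange_nonsplit_two_of_tameRoadFieldTwistedTwo W p t K hK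
  have h2d : (2 : ℤ) ∣ NumberField.discr K := two_dvd_discr_of_nonsplitClassAtTwo W t K hK.2.2.2.1
  obtain ⟨hKiq, -, htw, -, hsplitq, hpK⟩ := hK
  obtain ⟨-, ht, hadd₂, hmult₂⟩ := htw
  have hK2 : Module.finrank ℚ K = 2 := hKiq.1
  have hpsplit : ((Ideal.span {(p : ℤ)}).primesOver (𝓞 K)).ncard = 2 := hpK p Fact.out (dvd_refl p)
  -- the SEMISTABLE partner `V₀ ≅ E^{(p*·d)}`, `d = t · ∏ ℓ*` (multiplicative at `2`, `d ≢ 1 (mod 4)`)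
  obtain ⟨V, iV, iVm, C, d, hCV, hpd, hd4, hdpr, hsq, hpN, hsurjV, h2NV⟩ :=
    TwistTypePartnerData.exists_semistable_partner_data_dyadic W p hp5 hcell hsurj htt ht hadd₂ hmult₂
  haveI := iV
  haveI := iVm
  have hVW : ∃ C' : WeierstrassCurve.VariableChange ℚ, C' • W.quadraticTwist ((-1 : ℚ) ^ (p / 2) * p * d) = V :=
    ⟨C, hCV⟩
  -- the ODD primes of `d` divide `N_E`, hence split in `K`
  have hsplitd : ∀ ℓ : ℕ, ℓ.Prime → (ℓ : ℤ) ∣ d → ℓ ≠ 2 → ((Ideal.span {(ℓ : ℤ)}).primesOver (𝓞 K)).ncard = 2 :=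
    fun ℓ hℓ hℓd hℓ2 ↦ hsplitq ℓ hℓ (hdpr ℓ hℓ hℓd) hℓ2
  have h2V : ((Ideal.span {(2 : ℤ)}).primesOver (𝓞 K)).ncard ≠ 2 → 2 ∣ V.conductorNorm ℤ := fun _ ↦ h2NV
  have hNW : ((N : ℕ) : ℤ) = (W.conductorNorm ℤ : ℤ) := by rw [hN]
  have hq' : ∃ q' : ℕ, q'.Prime ∧ q' ∣ V.conductorNorm ℤ ∧ ((Ideal.span {(q' : ℤ)}).primesOver (𝓞 K)).ncard ≠ 2 :=
    ⟨2, Nat.prime_two, h2NV, Hsieh2014.ncard_primesOver_ne_two_of_dvd_discr K hK2 Nat.prime_two h2d⟩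
  have hirr : (V.baseChange K).HasIrreducibleModPGaloisRep p := irrK_of_surj V p hsurjV K hK2
  -- existence of CLW's imprimitive two-variable `L`-function as a pair `(A, C(p^k)·B)` (§6.1, reading R2₂)
  obtain ⟨Ωinf, Cc, Ωp, S, k, A, B, hΩinf, hCc, -, -, hCLW, hB0⟩ :=
    h61 ι' V W K 𝔭 𝔭' κ₁ κ γ₁ γ Dt.isNewformOf (V.conductorNorm ℤ) d hVW hpd hd4 h2NV hcut h2d hbc hsplitd hNW rfl hp2 hsq hpN hKiq
      hpsplit h𝔭 h𝔭' hne hind hq' h2V hirr hκ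
  set B' : PowerSeries (PowerSeries (PadicComplexInt p)) :=
    PowerSeries.C (PowerSeries.C (((p : ℕ) : PadicComplexInt p) ^ k)) * B with hB'
  have hB'0 : PowerSeries.constantCoeff B' ≠ 0 := by
    rw [hB', map_mul, PowerSeries.constantCoeff_C]
    refine mul_ne_zero ?_ hB0
    rw [Ne, PowerSeries.ext_iff, not_forall]
    refine ⟨0, ?_⟩
    rw [PowerSeries.coeff_C, if_pos rfl, map_zero]
    exact pow_ne_zero _ (by exact_mod_cast (Fact.out : p.Prime).ne_zero)
  -- (T): torsion of `X_Gr₂` (p714502; road-prime free)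
  have hXtors : Module.IsTorsion (IwasawaAlgebra₂ p) ((W.baseChange K).XGr₂ p κ₁ κ 𝔭' γ₁ γ) :=
    TameXGr₂Torsion.isTorsion_XGr₂_cellGordTwo W p K hcell hp5 hsurj hKiq hpsplit κ₁ κ γ₁ γ 𝔭' h𝔭' htors
  -- (i): print Thm. 8.2.1 ∘ JSW 6.1.6 (reading R2₂) at the pair `(A, B′)`
  obtain ⟨h, hh, hincl⟩ :=
    h821 ι' V W K 𝔭 𝔭' κ₁ κ γ₁ γ Dt.isNewformOf (V.conductorNorm ℤ) d hVW hpd hd4 h2NV hcut h2d hbc hsplitd hNW rfl hp2 hsq hpN hKiq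
      hpsplit h𝔭 h𝔭' hne hind hq' h2V hirr hκ hXtors Ωinf Cc Ωp A B' hΩinf hCc hCLW (X11b.R1.toCpInt p)
      (fun x ↦ X11b.R1.coe_toCpInt p x)
  -- (ii): the anticyclotomic restriction (dyadic twisted frame, reading R3₂)
  obtain ⟨ΩK', Ωp', Q', D, hΩK', hΩp', hQ', hAB, hD0, hDQ'⟩ :=
    exists_frame_and_restriction_twisted_two hB W p K hp5 hcell.2.1 hsurj hKiq hpsplit ht h2d hmult₂ hbc hsplitq
      Dt hN κ hκ γ 𝔭 h𝔭 𝔭' ι' hind κ₁ γ₁ Ωinf Cc Ωp A B' hΩinf hCc hCLW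
  exact ⟨A, B', h, ΩK', Ωp', Q', D, hh, hΩK', hΩp', hQ', hincl, hB'0, hAB, hD0, hDQ'⟩

/-- THE ANTICYCLOTOMIC SPECIALISATION OF THE TWO-VARIABLE GREENBERG CHARACTERISTIC IDEAL LIES IN THE ♭-FRAME'S IDEAL (DYADIC twisted road field; the `ℓ₀ = 2`
sibling of `greenbergInclusion_twisted_loose`, verbatim): for every ♭-datum with a ♭-frame `Q` and every completing pair there is `k` with `C(p^k)·w ∈ (Q)`
for every `w` in the specialisation `T₁ ↦ 0` of `ch_{Λ₂}(X_Gr₂(E_K)_{𝔭′})·Λ^ur`. Proof: `awayFromCyc_twisted_two`; `(Q′) = (Q)` by ideal rigidity across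
♭-frames (`X11b.R1.span_singleton_eq_of_isBDPLFunctionInt`); the `T₁`-cancellation `TameAwayFromCyc.exists_C_pow_mul_mem_span_of_frac`.
[cite: CastellaLiuWan2022, Thm. 8.2.1 (p. 85) (Forum Math. Sigma 10 (2022) e110)] [cite: Wan2020RankinSelbergIMC, §7.5 (arXiv:1408.4044v5)] -/
theorem greenbergInclusion_twisted_two
    (hB : Hsieh2014.thmB_exists_isHsiehLFunction_coeff_norm_eq_one_unrPeriod_ramifiedTwistedSteinbergAtTwo)
    (h821 : CastellaLiuWan2022.thm821_XGr₂_charIdeal_mul_le_awayFromCyc_semistableTwistRamifiedAtTwo)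
    (h61 : CastellaLiuWan2022.sec61_exists_isCastellaLiuWanLFunction₂_semistableTwistRamifiedAtTwo)
    (W : WeierstrassCurve ℚ) [W.IsElliptic] [W.IsGloballyMinimal] (p : ℕ) [Fact p.Prime]
    {t : ℤ} (K : Type) [Field K] [NumberField K]
    (hcell : N10.CellGordTwo W p) (hp5 : 5 ≤ p) (hsurj : Surj W p)
    (htt : ∀ r : Nat.Primes, (r : ℕ) ≠ 2 → W.HasAdditiveReductionAt ((primesEquiv (R := ℤ)).symm r) →
      ¬ (W.quadraticTwist (((-1 : ℤ) ^ ((r : ℕ) / 2) * r : ℤ) : ℚ)).HasAdditiveReductionAt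
        ((primesEquiv (R := ℤ)).symm r))
    (hK : TameRoadFieldTwistedTwo W p t K) :
    ∀ (N : ℕ) [NeZero N] (Dt : ModularParametrizationData W N), W.conductorNorm ℤ = N →
    ∀ (κ : ZpExtension K p), κ.IsAnticyclotomic → ∀ (γ : Field.absoluteGaloisGroup K) [Fact (κ.IsTopGenerator γ)]
      (𝔭 : HeightOneSpectrum (𝓞 K)), ((p : ℕ) : 𝓞 K) ∈ 𝔭.asIdeal → 𝔭.asIdeal.ramificationIdx (𝓞 ℚ) = 1 →
      𝔭.asIdeal.inertiaDeg (𝓞 ℚ) = 1 → ∀ (𝔭' : HeightOneSpectrum (𝓞 K)), ((p : ℕ) : 𝓞 K) ∈ 𝔭'.asIdeal → 𝔭' ≠ 𝔭 →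
      ∀ (ι' : PadicAlgCl p ≃+* ℂ), SchneiderFree.BranchInducesPrime p ι' 𝔭 →
      ∀ (ΩK : ℂ) (Ωp : ℂ_[p]) (Q : PowerSeries (PadicComplexInt p)), ΩK ≠ 0 → Ωp ≠ 0 →
        X11b.R1.IsBDPLFunctionInt p ι' 𝔭 κ γ Dt.f ΩK Ωp Q →
        Module.IsTorsion (IwasawaAlgebra p) (X11b.AcSelmer.XAc (W.baseChange K) p κ 𝔭' ∅ γ) →
        ∀ (κ₁ : ZpExtension K p) (γ₁ : Field.absoluteGaloisGroup K) [Fact (ZpExtension.IsTopGeneratorPair κ₁ κ γ₁ γ)],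
          ∃ k : ℕ,
            ∀ w ∈ ((WeierstrassCurve.XGr₂.charIdeal (W.baseChange K) p κ₁ κ 𝔭' γ₁ γ).map
                (IwasawaAlgebra₂.toUnr₂ p (X11b.R1.toCpInt p))).map
                (PowerSeries.constantCoeff (R := PowerSeries (PadicComplexInt p))),
              PowerSeries.C (((p : ℕ) : PadicComplexInt p) ^ k) * w ∈ Ideal.span {Q} := by
  intro N _ Dt hN κ hκ γ hγ 𝔭 h𝔭 he hf 𝔭' h𝔭' hne ι' hind ΩK Ωp Q hΩK hΩp hBDP htors κ₁ γ₁ hpair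
  obtain ⟨A, B, h, ΩK', Ωp', Q', D, hh, hΩK', hΩp', hQ', hincl, hB0, hAB, hD0, hDQ'⟩ :=
    awayFromCyc_twisted_two hB h821 h61 W p K hcell hp5 hsurj htt hK N Dt hN κ hκ γ 𝔭 h𝔭 he hf 𝔭' h𝔭' hne ι'
      hind htors κ₁ γ₁
  have hp2 : p ≠ 2 := by omega
  -- `(Q′) = (Q)`: ideal rigidity across ♭-frames
  have hQQ' : Ideal.span ({Q'} : Set (PowerSeries (PadicComplexInt p))) = Ideal.span {Q} :=
    X11b.R1.span_singleton_eq_of_isBDPLFunctionInt hp2 hK.1 hκ hγ.out hΩK hΩK' hΩp hΩp' hBDP hQ'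
  obtain ⟨k, hk⟩ := TameAwayFromCyc.exists_C_pow_mul_mem_span_of_frac _ A B D hB0 hD0 hAB h hh hincl
  refine ⟨k, fun w hw ↦ ?_⟩
  rw [← hQQ']
  exact hDQ' (hk w hw)

/-- THE ♭-INCLUSION FOR UNIT-CONTENT FRAMES AT TORSION DATA OVER A DYADIC TWISTED ROAD FIELD (the `ℓ₀ = 2` sibling of
`flatInclusion_twisted_loose`, verbatim: the Heegner clause is the predicate's sixth field): `Ch_Λ(X_ac^∅(E_K)_{𝔭′})·𝓞_{ℂ_p}⟦T⟧ ⊆ (Q)` for every unit-content ♭-frame `Q` at `Λ`-torsion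
data. Proof: `E(K)[p] = 0`, a completing generator pair, the tame local vanishing (`TameLocalVanishing.tameLocalVanishing_cellGordTwo`) and tame exact
control (`TameExactControl.tameExactControl_of_localVanishing`), `greenbergInclusion_twisted_two` at that pair, then
`TameSpecialization.S2L.charIdeal_XAc_map_le_span_of_twoVarSpec`. [cite: JetchevSkinnerWan2017, §3.4 Lemma 3.4.1 and Thm. 6.1.4–6.1.5 (arXiv:1512.06894 pp. 14–15, 26)]
[cite: SkinnerUrban2014, Prop. 3.2.8 (p. 23)] -/
theorem flatInclusion_twisted_two
    (hB : Hsieh2014.thmB_exists_isHsiehLFunction_coeff_norm_eq_one_unrPeriod_ramifiedTwistedSteinbergAtTwo)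
    (h821 : CastellaLiuWan2022.thm821_XGr₂_charIdeal_mul_le_awayFromCyc_semistableTwistRamifiedAtTwo)
    (h61 : CastellaLiuWan2022.sec61_exists_isCastellaLiuWanLFunction₂_semistableTwistRamifiedAtTwo)
    (W : WeierstrassCurve ℚ) [W.IsElliptic] [W.IsGloballyMinimal] (p : ℕ) [Fact p.Prime]
    {t : ℤ} (K : Type) [Field K] [NumberField K]
    (hcell : N10.CellGordTwo W p) (hp5 : 5 ≤ p) (hsurj : Surj W p)
    (htt : ∀ r : Nat.Primes, (r : ℕ) ≠ 2 → W.HasAdditiveReductionAt ((primesEquiv (R := ℤ)).symm r) →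
      ¬ (W.quadraticTwist (((-1 : ℤ) ^ ((r : ℕ) / 2) * r : ℤ) : ℚ)).HasAdditiveReductionAt
        ((primesEquiv (R := ℤ)).symm r))
    (hK : TameRoadFieldTwistedTwo W p t K) :
    ∀ (N : ℕ) [NeZero N] (Dt : ModularParametrizationData W N), W.conductorNorm ℤ = N →
    ∀ (κ : ZpExtension K p), κ.IsAnticyclotomic → ∀ (γ : Field.absoluteGaloisGroup K) [Fact (κ.IsTopGenerator γ)]
      (𝔭 : HeightOneSpectrum (𝓞 K)), ((p : ℕ) : 𝓞 K) ∈ 𝔭.asIdeal → 𝔭.asIdeal.ramificationIdx (𝓞 ℚ) = 1 →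
      𝔭.asIdeal.inertiaDeg (𝓞 ℚ) = 1 → ∀ (𝔭' : HeightOneSpectrum (𝓞 K)), ((p : ℕ) : 𝓞 K) ∈ 𝔭'.asIdeal → 𝔭' ≠ 𝔭 →
      ∀ (ι' : PadicAlgCl p ≃+* ℂ), SchneiderFree.BranchInducesPrime p ι' 𝔭 →
      ∀ (ΩK : ℂ) (Ωp : ℂ_[p]) (Q : PowerSeries (PadicComplexInt p)), ΩK ≠ 0 → Ωp ≠ 0 →
        X11b.R1.IsBDPLFunctionInt p ι' 𝔭 κ γ Dt.f ΩK Ωp Q →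
        Module.IsTorsion (IwasawaAlgebra p) (X11b.AcSelmer.XAc (W.baseChange K) p κ 𝔭' ∅ γ) →
        GreenbergVatsal2000.HasUnitContent Q →
        (X11b.AcSelmer.XAc.charIdeal (W.baseChange K) p κ 𝔭' ∅ γ).map (PowerSeries.map (X11b.R1.toCpInt p)) ≤
          Ideal.span {Q} := by
  intro N _ Dt hN κ hκ γ hγ 𝔭 h𝔭 he hf 𝔭' h𝔭' hne ι' hind ΩK Ωp Q hΩK hΩp hBDP htors hμ
  have hp : p.Prime := Fact.out
  have hp2 : p ≠ 2 := by omega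
  haveI hEK : (W.baseChange K).IsElliptic := by rw [baseChange]; infer_instance
  -- `E(K)[p] = 0`
  have htor := Literature.NumberTheory.EllipticCurves.torsionBy_eq_bot_of_isImaginaryQuadratic W K hK.1 hp hp2 hsurj
  have hKp : ∀ P : (W.baseChange K).toAffine.Point, p • P = 0 → P = 0 := fun P hP => by
    have hmem : P ∈ AddSubgroup.torsionBy (W.baseChange K).toAffine.Point (p : ℤ) :=
      AddSubgroup.torsionBy.nsmul_iff.mpr hP
    rw [htor] at hmem
    exact AddSubgroup.mem_bot.mp hmem
  -- the completing pair, tame local vanishing and tame exact control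
  obtain ⟨κ₁, γ₁, hpair⟩ := TameGeneratorPair.exists_isTopGeneratorPair_of_isImaginaryQuadratic hK.1 κ γ hγ.out
  haveI hpairI : Fact (ZpExtension.IsTopGeneratorPair κ₁ κ γ₁ γ) := ⟨hpair⟩
  have hvan : ∀ m : (W.baseChange K).geomPrimaryTorsion p,
      (∀ x : Field.absoluteGaloisGroup K, x ∈ ZpExtension.pairKer κ₁ κ → x ∈ GreenbergSelmer.inertia 𝔭' → x • m = m) →
        m = 0 := fun m hm =>
    TameLocalVanishing.tameLocalVanishing_cellGordTwo W p K hcell hp5 hK.1.1 (hK.2.2.2.2.2 p Fact.out (dvd_refl p))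
      κ₁ κ 𝔭' h𝔭' m hm
  obtain ⟨m, hm⟩ :=
    TameExactControl.tameExactControl_of_localVanishing W p hp2 hsurj K hK.1 κ₁ κ γ₁ γ 𝔭' h𝔭' hvan
  -- the two-variable specialised inclusion at that pair, then the proved specialisation
  have h2i := greenbergInclusion_twisted_two hB h821 h61 W p K hcell hp5 hsurj htt hK N Dt hN κ hκ γ 𝔭 h𝔭 he hf 𝔭'
    h𝔭' hne ι' hind ΩK Ωp Q hΩK hΩp hBDP htors κ₁ γ₁
  exact TameSpecialization.S2L.charIdeal_XAc_map_le_span_of_twoVarSpec (W.baseChange K) p κ₁ κ 𝔭' γ₁ γ hKp htors ⟨m, hm⟩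
    (X11b.R1.toCpInt p) Q hμ h2i

end FlatChain

end Summit.BirchSwinnertonDyer.BirchSwinnertonDyer.Theorems.TwistedWanRoad

end
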